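import Summits.MatrixMultiplication.MatrixMultiplication.Theses.DefinableSTPPDichotomy
import Summits.MatrixMultiplication.MatrixMultiplication.Theorems.PairwiseCurvedTilingsLC.Negative.UniformEta

/-!
# `PairwiseCurvedTilingsLC` (crux stmt-MatrixMultiplication-17883): isolating translates, the
`B − C` packing, and the counting "shadow bound on the big blocks ⇒ mass ≤ K·q^m"

Negative-side lemmas (refuter / cdisprove seat, cycle 1; the combinatorial core of the conditional
disproof found by the crux-ideate seats k=1, k=2 of round 1, 2026-08-17), elementary and
sorry-free, for a family `(A_x, B_x, C_x)_{x ∈ I}` of finite subsets of a finite abelian group `H`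
satisfying the route's PAIRWISE STPP clause (inlined verbatim, as in `UniformEta.lean`, whose three
packings and block-TPP bound are reused):

* `isolating_translates` — pattern `k = i` of the clause: for `b ∈ B_i`, `c ∈ C_i`,
  `a₀ ≠ a ∈ A_i`, the translate `(b − c) + a − a₀` lies in NO class `B_j − C_j` (`j ≠ i`:
  porosity of the `B − C` packing along `A − A`; `j = i`: block TPP);
* `card_bcShadow` — the packing `|⋃_x (B_x − C_x)| = Σ_x |B_x||C_x|`;
* `mass_le_of_bcShadowBound` — if the blocks with `|A_x| > C` have `Σ |B_x||C_x| ≤ C q^{m−1}`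
  (`|H| = q^m`), then for `0 < ε ≤ 1`, `mε ≤ 1`, the mass `Σ_x (|A_x||B_x||C_x|)^{(2+ε)/3}` is at
  most `(C + (2+C)/3)·q^m` (small blocks: `(abc)^{(2+ε)/3} ≤ abc ≤ C·bc`; big blocks: three-term
  AM–GM with weights `q^{-1/3}, q^{2/3}, q^{-1/3}` on `ab, bc, ca`, `rpow_block_le_bc`);
* `bcShadow_le_of_recurrence` — if every non-exceptional point `t` of the shadow is translated
  into the shadow by `≥ c|A_x|²` of the pairs `(a₀, a) ∈ A_x²` whenever `|A_x| > K` (the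
  RECURRENCE inequality; for definable families in large characteristic this is the hypothesis
  `DefinableTranslateRecurrenceLC` of the companion file
  `PairwiseCurvedTilingsLCFalseOfDefinableTranslateRecurrenceLC.lean`), then the blocks with
  `|A_x| > max K ⌈1/c⌉` have their whole `B − C` shadow inside the exceptional set: by
  `isolating_translates` only the `|A_x|` diagonal pairs translate a shadow point into the shadow.

Together: recurrence off a set of size `C q^{m−1}` caps the mass of a pairwise-STPP family at
`K_c q^m`, which is what kills the crux's `|F|^{m+η}` (companion file).

References: H. Cohn, R. Kleinberg, B. Szegedy, C. Umans, FOCS 2005 (arXiv:math/0511460) Def. 5.1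
(the STPP clause); J. Blasiak, T. Church, H. Cohn, J. A. Grochow, E. Naslund, W. F. Sawin,
C. Umans, Discrete Analysis 2017:3 (arXiv:1605.06702) §2 (packings).
-/

set_option linter.dupNamespace false  -- `Summit.<S>.<S>.…` is the mandated namespace

namespace Summit.MatrixMultiplication.MatrixMultiplication.Theorems.PairwiseCurvedTilingsLC.Negative

open Finset

/-! ## §1 Isolating translates and the `B − C` packing (pattern `k = i` of the pairwise clause) -/

section Core

variable {H : Type*} [AddCommGroup H] {ι : Type*}

variable {I : Finset ι} {A B C : ι → Finset H}
  (hP : ∀ i ∈ I, ∀ j ∈ I, ∀ k ∈ I, (i = j ∨ j = k ∨ k = i) →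
      ∀ s ∈ A k, ∀ s' ∈ A i, ∀ t ∈ B i, ∀ t' ∈ B j, ∀ u ∈ C j, ∀ u' ∈ C k,
        (s' - s) + (t' - t) + (u' - u) = 0 → i = j ∧ j = k ∧ s = s' ∧ t = t' ∧ u = u')
include hP

/-- **Isolating translates** (crux-ideate k=2's combinatorial core; pattern `k = i`): for
`b ∈ B_i`, `c ∈ C_i`, `a₀ ≠ a ∈ A_i`, the translate `(b − c) + a − a₀` lies in no class `B_j − C_j`
(`j ≠ i`: porosity of the `B − C` packing along `A − A`; `j = i`: block TPP). [folklore] -/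
theorem isolating_translates {i : ι} (hi : i ∈ I) {b c a₀ a : H} (hb : b ∈ B i) (hc : c ∈ C i)
    (ha₀ : a₀ ∈ A i) (ha : a ∈ A i) (hne : a ≠ a₀) {j : ι} (hj : j ∈ I) {b' c' : H}
    (hb' : b' ∈ B j) (hc' : c' ∈ C j) : (b - c) + a - a₀ ≠ b' - c' := by
  intro he
  have h0 : (a₀ - a) + (b' - b) + (c - c') = 0 := by
    have : (a₀ - a) + (b' - b) + (c - c') = (b' - c') - ((b - c) + a - a₀) := by abel
    rw [this, he, sub_self]
  exact hne (hP i hi j hj i hi (Or.inr (Or.inr rfl)) a ha a₀ ha₀ b hb b' hb' c' hc' c hc h0).2.2.1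

/-- **`B − C` packing:** `|⋃_k (B_k − C_k)| = Σ_k |B_k||C_k|` when all `A_k ≠ ∅` (pattern `k = i`
with `s = s'`: the classes are pairwise disjoint and `(b, c) ↦ b − c` is injective on each).
[folklore; BCCGNSU 2017 §2] -/
theorem card_bcShadow [DecidableEq H] (hA : ∀ k ∈ I, (A k).Nonempty) :
    (Finset.biUnion I (fun x => Finset.image₂ (fun b c => b - c) (B x) (C x))).card =
      ∑ k ∈ I, (B k).card * (C k).card := by
  rw [card_biUnion]
  · refine sum_congr rfl fun k hk => ?_
    rw [card_image₂_iff.2]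
    intro ⟨b, c⟩ hbc ⟨b', c'⟩ hbc' heq
    simp only [Set.mem_prod, mem_coe] at hbc hbc'
    obtain ⟨a, ha⟩ := hA k hk
    have h0 : (a - a) + (b' - b) + (c - c') = 0 := by
      have : (a - a) + (b' - b) + (c - c') = (b' - c') - (b - c) := by abel
      rw [this]; exact sub_eq_zero.2 heq.symm
    obtain ⟨-, -, -, hbb, hcc⟩ :=
      hP k hk k hk k hk (Or.inl rfl) a ha a ha b hbc.1 b' hbc'.1 c' hbc'.2 c hbc.2 h0
    exact Prod.ext hbb hcc.symm
  · intro k hk l hl hkl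
    rw [Function.onFun, disjoint_left]
    intro v hvk hvl
    simp only [mem_image₂] at hvk hvl
    obtain ⟨b, hb, c, hc, rfl⟩ := hvk
    obtain ⟨b', hb', c', hc', he⟩ := hvl
    obtain ⟨a, ha⟩ := hA k hk
    have h0 : (a - a) + (b' - b) + (c - c') = 0 := by
      have : (a - a) + (b' - b) + (c - c') = (b' - c') - (b - c) := by abel
      rw [this, he, sub_self]
    exact hkl (hP k hk l hl k hk (Or.inr (Or.inr rfl)) a ha a ha b hb b' hb' c' hc' c hc h0).1

/-- Restriction of the pairwise clause to a sub-index-set. -/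
theorem pairwise_mono {J : Finset ι} (hJI : J ⊆ I) :
    ∀ i ∈ J, ∀ j ∈ J, ∀ k ∈ J, (i = j ∨ j = k ∨ k = i) →
      ∀ s ∈ A k, ∀ s' ∈ A i, ∀ t ∈ B i, ∀ t' ∈ B j, ∀ u ∈ C j, ∀ u' ∈ C k,
        (s' - s) + (t' - t) + (u' - u) = 0 → i = j ∧ j = k ∧ s = s' ∧ t = t' ∧ u = u' :=
  fun i hi j hj k hk => hP i (hJI hi) j (hJI hj) k (hJI hk)

end Core

/-! ## §2 Counting: a shadow bound on the big blocks caps the mass -/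

section MassBound

/-- Per-block inequality: three-term AM–GM with weights `1/3` on `(λab, μbc, λca)`,
`λ = q^{-1/3}`, `μ = q^{2/3}` (`λ·μ·λ = 1`), times `(abc)^{ε/3} ≤ q^{mε/3} ≤ q^{1/3}`. [folklore] -/
theorem rpow_block_le_bc {q : ℝ} (hq : 1 ≤ q) {m : ℕ} {a b c : ℝ} (ha : 0 ≤ a) (hb : 0 ≤ b)
    (hc : 0 ≤ c) (h1 : 1 ≤ a * b * c) (hqm : a * b * c ≤ q ^ (m : ℝ)) {ε : ℝ} (hε : 0 < ε)
    (hmε : (m : ℝ) * ε ≤ 1) :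
    (a * b * c) ^ ((2 + ε) / 3) ≤ q ^ ((1 : ℝ) / 3) *
      ((q ^ (-(1 : ℝ) / 3) * (a * b) + q ^ ((2 : ℝ) / 3) * (b * c) +
        q ^ (-(1 : ℝ) / 3) * (c * a)) / 3) := by
  have hq0 : 0 < q := by linarith
  have hN : 0 < a * b * c := by linarith
  have hlm : q ^ (-(1 : ℝ) / 3) * q ^ ((2 : ℝ) / 3) * q ^ (-(1 : ℝ) / 3) = 1 := by
    rw [← Real.rpow_add hq0, ← Real.rpow_add hq0]; norm_num
  have hsplit : (a * b * c) ^ ((2 + ε) / 3) =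
      (a * b * c) ^ ((2 : ℝ) / 3) * (a * b * c) ^ (ε / 3) := by
    rw [← Real.rpow_add hN]; congr 1; ring
  have h2 : (a * b * c) ^ (ε / 3) ≤ q ^ ((1 : ℝ) / 3) := by
    calc (a * b * c) ^ (ε / 3) ≤ (q ^ (m : ℝ)) ^ (ε / 3) :=
          Real.rpow_le_rpow hN.le hqm (by linarith)
      _ = q ^ ((m : ℝ) * (ε / 3)) := by rw [← Real.rpow_mul hq0.le]
      _ ≤ q ^ ((1 : ℝ) / 3) := Real.rpow_le_rpow_of_exponent_le hq (by nlinarith)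
  have hg := Real.geom_mean_le_arith_mean3_weighted (w₁ := 1 / 3) (w₂ := 1 / 3) (w₃ := 1 / 3)
    (p₁ := q ^ (-(1 : ℝ) / 3) * (a * b)) (p₂ := q ^ ((2 : ℝ) / 3) * (b * c))
    (p₃ := q ^ (-(1 : ℝ) / 3) * (c * a)) (by norm_num) (by norm_num) (by norm_num)
    (by positivity) (by positivity) (by positivity) (by norm_num)
  have hprod : (q ^ (-(1 : ℝ) / 3) * (a * b)) ^ ((1 : ℝ) / 3) *
      (q ^ ((2 : ℝ) / 3) * (b * c)) ^ ((1 : ℝ) / 3) *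
      (q ^ (-(1 : ℝ) / 3) * (c * a)) ^ ((1 : ℝ) / 3) = (a * b * c) ^ ((2 : ℝ) / 3) := by
    rw [← Real.mul_rpow (by positivity) (by positivity),
      ← Real.mul_rpow (by positivity) (by positivity)]
    have e : q ^ (-(1 : ℝ) / 3) * (a * b) * (q ^ ((2 : ℝ) / 3) * (b * c)) *
        (q ^ (-(1 : ℝ) / 3) * (c * a)) = (a * b * c) ^ (2 : ℕ) := by
      have : q ^ (-(1 : ℝ) / 3) * (a * b) * (q ^ ((2 : ℝ) / 3) * (b * c)) *
          (q ^ (-(1 : ℝ) / 3) * (c * a)) =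
          (q ^ (-(1 : ℝ) / 3) * q ^ ((2 : ℝ) / 3) * q ^ (-(1 : ℝ) / 3)) * (a * b * c) ^ (2 : ℕ) := by
        ring
      rw [this, hlm, one_mul]
    rw [e, ← Real.rpow_natCast, ← Real.rpow_mul hN.le]
    norm_num
  have h1 : (a * b * c) ^ ((2 : ℝ) / 3) ≤
      (q ^ (-(1 : ℝ) / 3) * (a * b) + q ^ ((2 : ℝ) / 3) * (b * c) +
        q ^ (-(1 : ℝ) / 3) * (c * a)) / 3 := by
    rw [← hprod]; linarith
  rw [hsplit]
  calc (a * b * c) ^ ((2 : ℝ) / 3) * (a * b * c) ^ (ε / 3)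
      ≤ ((q ^ (-(1 : ℝ) / 3) * (a * b) + q ^ ((2 : ℝ) / 3) * (b * c) +
          q ^ (-(1 : ℝ) / 3) * (c * a)) / 3) * q ^ ((1 : ℝ) / 3) :=
        mul_le_mul h1 h2 (by positivity) (by positivity)
    _ = _ := by ring

variable {H : Type*} [AddCommGroup H] [Fintype H] {ι : Type*} {I : Finset ι} {A B C : ι → Finset H}
  (hP : ∀ i ∈ I, ∀ j ∈ I, ∀ k ∈ I, (i = j ∨ j = k ∨ k = i) →
      ∀ s ∈ A k, ∀ s' ∈ A i, ∀ t ∈ B i, ∀ t' ∈ B j, ∀ u ∈ C j, ∀ u' ∈ C k,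
        (s' - s) + (t' - t) + (u' - u) = 0 → i = j ∧ j = k ∧ s = s' ∧ t = t' ∧ u = u')
include hP

set_option maxHeartbeats 1600000 in
-- the final `calc` chains over large real expressions are slow to elaborate
/-- **Mass bound from a `B − C` shadow bound on the big blocks.**  For a family satisfying the
pairwise clause in a finite abelian group of order `q^m` (`q ≥ 1`): if the blocks with `|A_x| > C`
have `Σ |B_x||C_x| ≤ C q^{m−1}`, then for every `0 < ε ≤ 1` with `mε ≤ 1` the mass at exponent
`(2+ε)/3` is at most `(C + (2+C)/3)·q^m`.  (Small blocks: `(abc)^{(2+ε)/3} ≤ abc ≤ C·bc` and the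
`B − C` packing; big blocks: `rpow_block_le_bc` and the three packings.) -/
theorem mass_le_of_bcShadowBound (Cb : ℕ) {q : ℝ} (hq : 1 ≤ q) (m : ℕ)
    (hH : (Fintype.card H : ℝ) = q ^ (m : ℝ))
    (hshadow : ∑ x ∈ I.filter (fun x => Cb < (A x).card), ((B x).card : ℝ) * (C x).card
      ≤ Cb * q ^ ((m : ℝ) - 1))
    {ε : ℝ} (hε : 0 < ε) (hε1 : ε ≤ 1) (hmε : (m : ℝ) * ε ≤ 1) :
    ∑ x ∈ I, (((A x).card * (B x).card * (C x).card : ℕ) : ℝ) ^ ((2 + ε) / 3)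
      ≤ ((Cb : ℝ) + (2 + Cb) / 3) * q ^ (m : ℝ) := by
  have hq0 : 0 < q := by linarith
  have hp0 : 0 < (2 + ε) / 3 := by linarith
  have hp1 : (2 + ε) / 3 ≤ 1 := by linarith
  -- blocks with all three sets non-empty (the others carry no mass)
  set I₀ := I.filter (fun x => (A x).Nonempty ∧ (B x).Nonempty ∧ (C x).Nonempty) with hI₀def
  have hI₀I : I₀ ⊆ I := by rw [hI₀def]; exact filter_subset _ _
  have hne : ∀ x ∈ I₀, (A x).Nonempty ∧ (B x).Nonempty ∧ (C x).Nonempty := fun x hx => by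
    rw [hI₀def] at hx; exact (mem_filter.1 hx).2
  have hsum0 : ∑ x ∈ I, (((A x).card * (B x).card * (C x).card : ℕ) : ℝ) ^ ((2 + ε) / 3) =
      ∑ x ∈ I₀, (((A x).card * (B x).card * (C x).card : ℕ) : ℝ) ^ ((2 + ε) / 3) := by
    rw [hI₀def, sum_filter_of_ne]
    intro x _ hx
    by_contra hcon
    apply hx
    have h0 : (A x).card * (B x).card * (C x).card = 0 := by
      simp only [not_and_or, not_nonempty_iff_eq_empty] at hcon
      rcases hcon with h' | h' | h' <;> simp [h']
    rw [h0, Nat.cast_zero, Real.zero_rpow hp0.ne']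
  -- the three packings and block TPP (`UniformEta.lean`), as reals
  have hAC : ∑ x ∈ I₀, ((A x).card : ℝ) * (C x).card ≤ q ^ (m : ℝ) := by
    have := sum_card_AC_le hP (H := H); rw [← hI₀def] at this; rw [← hH]; exact_mod_cast this
  have hAB : ∑ x ∈ I₀, ((A x).card : ℝ) * (B x).card ≤ q ^ (m : ℝ) := by
    have := sum_card_AB_le hP (H := H); rw [← hI₀def] at this; rw [← hH]; exact_mod_cast this
  have hBC : ∑ x ∈ I₀, ((B x).card : ℝ) * (C x).card ≤ q ^ (m : ℝ) := by
    have := sum_card_BC_le hP (H := H); rw [← hI₀def] at this; rw [← hH]; exact_mod_cast this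
  have habc : ∀ x ∈ I₀, ((A x).card : ℝ) * (B x).card * (C x).card ≤ q ^ (m : ℝ) := by
    intro x hx
    rw [← hH]; exact_mod_cast card_mul_card_mul_card_le hP (hI₀I hx)
  have habc1 : ∀ x ∈ I₀, (1 : ℝ) ≤ ((A x).card : ℝ) * (B x).card * (C x).card := by
    intro x hx
    obtain ⟨ha, hb, hc⟩ := hne x hx
    have : 1 ≤ (A x).card * (B x).card * (C x).card :=
      Nat.mul_pos (Nat.mul_pos ha.card_pos hb.card_pos) hc.card_pos
    exact_mod_cast this
  have hcast : ∀ x, (((A x).card * (B x).card * (C x).card : ℕ) : ℝ) =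
      ((A x).card : ℝ) * (B x).card * (C x).card := fun x => by push_cast; ring
  rw [hsum0, ← sum_filter_add_sum_filter_not I₀ (fun x => Cb < (A x).card)]
  simp_rw [hcast]
  -- (1) small-`A` blocks: `(abc)^p ≤ abc ≤ Cb·bc`
  have hT : ∑ x ∈ I₀.filter (fun x => ¬ Cb < (A x).card),
      (((A x).card : ℝ) * (B x).card * (C x).card) ^ ((2 + ε) / 3) ≤ Cb * q ^ (m : ℝ) := by
    calc ∑ x ∈ I₀.filter (fun x => ¬ Cb < (A x).card),
          (((A x).card : ℝ) * (B x).card * (C x).card) ^ ((2 + ε) / 3)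
        ≤ ∑ x ∈ I₀.filter (fun x => ¬ Cb < (A x).card), (Cb : ℝ) * (((B x).card : ℝ) * (C x).card) := by
          refine sum_le_sum fun x hx => ?_
          obtain ⟨hx₀, hxa⟩ := mem_filter.1 hx
          have ha : ((A x).card : ℝ) ≤ Cb := by exact_mod_cast not_lt.1 hxa
          calc (((A x).card : ℝ) * (B x).card * (C x).card) ^ ((2 + ε) / 3)
              ≤ ((A x).card : ℝ) * (B x).card * (C x).card :=
                Real.rpow_le_self_of_one_le (habc1 x hx₀) hp1
            _ = ((A x).card : ℝ) * (((B x).card : ℝ) * (C x).card) := by ring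
            _ ≤ (Cb : ℝ) * (((B x).card : ℝ) * (C x).card) := by gcongr
      _ ≤ ∑ x ∈ I₀, (Cb : ℝ) * (((B x).card : ℝ) * (C x).card) :=
          sum_le_sum_of_subset_of_nonneg (filter_subset _ _) fun x _ _ => by positivity
      _ = Cb * ∑ x ∈ I₀, ((B x).card : ℝ) * (C x).card := by rw [mul_sum]
      _ ≤ Cb * q ^ (m : ℝ) := by gcongr
  -- (2) big-`A` blocks
  have hSI : I₀.filter (fun x => Cb < (A x).card) ⊆ I.filter fun x => Cb < (A x).card := by
    intro x hx
    obtain ⟨hx₀, hxa⟩ := mem_filter.1 hx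
    exact mem_filter.2 ⟨hI₀I hx₀, hxa⟩
  have hSsh : ∑ x ∈ I₀.filter (fun x => Cb < (A x).card), ((B x).card : ℝ) * (C x).card
      ≤ Cb * q ^ ((m : ℝ) - 1) :=
    (sum_le_sum_of_subset_of_nonneg hSI fun x _ _ => by positivity).trans hshadow
  have hSab : ∑ x ∈ I₀.filter (fun x => Cb < (A x).card), ((A x).card : ℝ) * (B x).card
      ≤ q ^ (m : ℝ) :=
    (sum_le_sum_of_subset_of_nonneg (filter_subset _ _) fun x _ _ => by positivity).trans hAB
  have hSca : ∑ x ∈ I₀.filter (fun x => Cb < (A x).card), ((C x).card : ℝ) * (A x).card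
      ≤ q ^ (m : ℝ) := by
    calc ∑ x ∈ I₀.filter (fun x => Cb < (A x).card), ((C x).card : ℝ) * (A x).card
        ≤ ∑ x ∈ I₀, ((C x).card : ℝ) * (A x).card :=
          sum_le_sum_of_subset_of_nonneg (filter_subset _ _) fun x _ _ => by positivity
      _ = ∑ x ∈ I₀, ((A x).card : ℝ) * (C x).card := sum_congr rfl fun x _ => mul_comm _ _
      _ ≤ q ^ (m : ℝ) := hAC
  have hS : ∑ x ∈ I₀.filter (fun x => Cb < (A x).card),
      (((A x).card : ℝ) * (B x).card * (C x).card) ^ ((2 + ε) / 3) ≤ (2 + Cb) / 3 * q ^ (m : ℝ) := by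
    calc ∑ x ∈ I₀.filter (fun x => Cb < (A x).card),
          (((A x).card : ℝ) * (B x).card * (C x).card) ^ ((2 + ε) / 3)
        ≤ ∑ x ∈ I₀.filter (fun x => Cb < (A x).card), q ^ ((1 : ℝ) / 3) *
            ((q ^ (-(1 : ℝ) / 3) * (((A x).card : ℝ) * (B x).card) +
              q ^ ((2 : ℝ) / 3) * (((B x).card : ℝ) * (C x).card) +
              q ^ (-(1 : ℝ) / 3) * (((C x).card : ℝ) * (A x).card)) / 3) := by
          refine sum_le_sum fun x hx => ?_
          have hx₀ : x ∈ I₀ := (mem_filter.1 hx).1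
          exact rpow_block_le_bc hq (Nat.cast_nonneg _) (Nat.cast_nonneg _) (Nat.cast_nonneg _)
            (habc1 x hx₀) (habc x hx₀) hε hmε
      _ = q ^ ((1 : ℝ) / 3) / 3 *
            (q ^ (-(1 : ℝ) / 3) * ∑ x ∈ I₀.filter (fun x => Cb < (A x).card),
                ((A x).card : ℝ) * (B x).card +
              q ^ ((2 : ℝ) / 3) * ∑ x ∈ I₀.filter (fun x => Cb < (A x).card),
                ((B x).card : ℝ) * (C x).card +
              q ^ (-(1 : ℝ) / 3) * ∑ x ∈ I₀.filter (fun x => Cb < (A x).card),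
                ((C x).card : ℝ) * (A x).card) := by
          rw [mul_sum, mul_sum, mul_sum, ← sum_add_distrib, ← sum_add_distrib, mul_sum]
          exact sum_congr rfl fun x _ => by ring
      _ ≤ q ^ ((1 : ℝ) / 3) / 3 *
            (q ^ (-(1 : ℝ) / 3) * q ^ (m : ℝ) + q ^ ((2 : ℝ) / 3) * (Cb * q ^ ((m : ℝ) - 1)) +
              q ^ (-(1 : ℝ) / 3) * q ^ (m : ℝ)) := by
          have hl0 : 0 ≤ q ^ (-(1 : ℝ) / 3) := (Real.rpow_pos_of_pos hq0 _).le
          have hm0 : 0 ≤ q ^ ((2 : ℝ) / 3) := (Real.rpow_pos_of_pos hq0 _).le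
          have hq3 : 0 ≤ q ^ ((1 : ℝ) / 3) / 3 := by positivity
          apply mul_le_mul_of_nonneg_left _ hq3
          exact add_le_add (add_le_add (mul_le_mul_of_nonneg_left hSab hl0)
            (mul_le_mul_of_nonneg_left hSsh hm0)) (mul_le_mul_of_nonneg_left hSca hl0)
      _ = (2 + Cb) / 3 * q ^ (m : ℝ) := by
          have e1 : q ^ ((1 : ℝ) / 3) * q ^ (-(1 : ℝ) / 3) * q ^ (m : ℝ) = q ^ (m : ℝ) := by
            rw [← Real.rpow_add hq0, ← Real.rpow_add hq0]; norm_num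
          have e2 : q ^ ((1 : ℝ) / 3) * q ^ ((2 : ℝ) / 3) * q ^ ((m : ℝ) - 1) = q ^ (m : ℝ) := by
            rw [← Real.rpow_add hq0, ← Real.rpow_add hq0]; norm_num
          have : q ^ ((1 : ℝ) / 3) / 3 *
              (q ^ (-(1 : ℝ) / 3) * q ^ (m : ℝ) + q ^ ((2 : ℝ) / 3) * (Cb * q ^ ((m : ℝ) - 1)) +
                q ^ (-(1 : ℝ) / 3) * q ^ (m : ℝ)) =
              (2 * (q ^ ((1 : ℝ) / 3) * q ^ (-(1 : ℝ) / 3) * q ^ (m : ℝ)) +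
                Cb * (q ^ ((1 : ℝ) / 3) * q ^ ((2 : ℝ) / 3) * q ^ ((m : ℝ) - 1))) / 3 := by ring
          rw [this, e1, e2]; ring
  calc ∑ x ∈ I₀.filter (fun x => Cb < (A x).card),
          (((A x).card : ℝ) * (B x).card * (C x).card) ^ ((2 + ε) / 3) +
        ∑ x ∈ I₀.filter (fun x => ¬ Cb < (A x).card),
          (((A x).card : ℝ) * (B x).card * (C x).card) ^ ((2 + ε) / 3)
      ≤ (2 + Cb) / 3 * q ^ (m : ℝ) + Cb * q ^ (m : ℝ) := add_le_add hS hT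
    _ = ((Cb : ℝ) + (2 + Cb) / 3) * q ^ (m : ℝ) := by ring

end MassBound

/-- The characteristic of a finite field is at most its cardinality. [folklore] -/
theorem ringChar_le_card (F : Type*) [Field F] [Fintype F] : ringChar F ≤ Fintype.card F := by
  obtain ⟨n, hp, hcard⟩ := FiniteField.card F (ringChar F)
  rw [hcard]
  exact Nat.le_self_pow n.ne_zero _

/-! ## §3 Recurrence off an exceptional set forces the big blocks' shadow into it -/

/-- **From recurrence to the shadow bound** (crux-ideate k=1).  Under the pairwise clause, if the
shadow `T = ⋃_x (B_x − C_x)` and the blocks `A_x` satisfy the recurrence inequality with constants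
`K, c` off an exceptional set `E`, then `Σ_{x : |A_x| > max K ⌈1/c⌉} |B_x||C_x| ≤ |E|`: a
non-exceptional point of a big block's class would be translated into the shadow by `c|A_x|² > |A_x|`
pairs, but by `isolating_translates` only the `|A_x|` diagonal pairs do so. -/
theorem bcShadow_le_of_recurrence {F : Type} [Field F] [Fintype F] [DecidableEq F] {e m : ℕ}
    {I : Finset (Fin e → F)} {A B C : (Fin e → F) → Finset (Fin m → F)}
    (hP : ∀ i ∈ I, ∀ j ∈ I, ∀ k ∈ I, (i = j ∨ j = k ∨ k = i) →
      ∀ s ∈ A k, ∀ s' ∈ A i, ∀ t ∈ B i, ∀ t' ∈ B j, ∀ u ∈ C j, ∀ u' ∈ C k,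
        (s' - s) + (t' - t) + (u' - u) = 0 → i = j ∧ j = k ∧ s = s' ∧ t = t' ∧ u = u')
    (E : Finset (Fin m → F)) {K : ℕ} {c : ℝ} (hc : 0 < c)
    (hrec : ∀ x ∈ I, K < (A x).card → ∀ t ∈ Finset.biUnion I (fun x => Finset.image₂ (fun b c => b - c) (B x) (C x)), t ∉ E →
      c * ((A x).card : ℝ) ^ 2 ≤ ((((A x) ×ˢ (A x)).filter
        fun p : (Fin m → F) × (Fin m → F) =>
          t + p.2 - p.1 ∈ Finset.biUnion I (fun x => Finset.image₂ (fun b c => b - c) (B x) (C x))).card : ℝ)) :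
    ∑ x ∈ I.filter (fun x => max K (Nat.ceil (1 / c)) < (A x).card), (B x).card * (C x).card
      ≤ E.card := by
  classical
  set I₁ := I.filter (fun x => max K (Nat.ceil (1 / c)) < (A x).card) with hI₁
  have hI₁I : I₁ ⊆ I := filter_subset _ _
  have hA₁ : ∀ x ∈ I₁, (A x).Nonempty := fun x hx =>
    card_pos.1 (lt_of_le_of_lt (Nat.zero_le _) (mem_filter.1 hx).2)
  -- the partial shadow over `I₁` is a packing of the right size, contained in the full shadow
  have hcard : (Finset.biUnion I₁ (fun x => Finset.image₂ (fun b c => b - c) (B x) (C x))).card =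
      ∑ x ∈ I₁, (B x).card * (C x).card :=
    card_bcShadow (pairwise_mono hP hI₁I) hA₁
  have hsub : Finset.biUnion I₁ (fun x => Finset.image₂ (fun b c => b - c) (B x) (C x)) ⊆
      Finset.biUnion I (fun x => Finset.image₂ (fun b c => b - c) (B x) (C x)) := by
    intro w hw
    simp only [mem_biUnion] at hw ⊢
    obtain ⟨x, hx, hw⟩ := hw
    exact ⟨x, hI₁I hx, hw⟩
  rw [← hcard]
  by_contra hlt
  push Not at hlt
  -- a non-exceptional point of the partial shadow
  obtain ⟨t, ht, htE⟩ : ∃ t ∈ Finset.biUnion I₁ (fun x => Finset.image₂ (fun b c => b - c) (B x) (C x)), t ∉ E := by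
    by_contra hall
    push Not at hall
    exact absurd (card_le_card (show Finset.biUnion I₁ (fun x => Finset.image₂ (fun b c => b - c) (B x) (C x)) ⊆ E from hall))
      (not_le.2 hlt)
  have ht' := ht
  simp only [mem_biUnion, mem_image₂] at ht'
  obtain ⟨x, hx, b, hb, c', hc', rfl⟩ := ht'
  obtain ⟨hxI, hxA⟩ := mem_filter.1 hx
  have hK : K < (A x).card := lt_of_le_of_lt (le_max_left _ _) hxA
  have hrecx := hrec x hxI hK (b - c') (hsub ht) htE
  -- but only diagonal pairs translate `t` into the shadow
  have hdiag : ((A x) ×ˢ (A x)).filter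
      (fun p : (Fin m → F) × (Fin m → F) =>
        (b - c') + p.2 - p.1 ∈ Finset.biUnion I (fun x => Finset.image₂ (fun b c => b - c) (B x) (C x)))
        ⊆ (A x).image fun a => (a, a) := by
    intro p hp
    obtain ⟨hp, hmem⟩ := mem_filter.1 hp
    obtain ⟨h1, h2⟩ := mem_product.1 hp
    simp only [mem_biUnion, mem_image₂] at hmem
    obtain ⟨j, hj, b'', hb'', c'', hc'', he⟩ := hmem
    have : p.2 = p.1 := by
      by_contra hne
      exact isolating_translates hP hxI hb hc' h1 h2 hne hj hb'' hc'' he.symm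
    exact mem_image.2 ⟨p.1, h1, Prod.ext rfl this.symm⟩
  have hle : ((((A x) ×ˢ (A x)).filter
      fun p : (Fin m → F) × (Fin m → F) =>
        (b - c') + p.2 - p.1 ∈ Finset.biUnion I (fun x => Finset.image₂ (fun b c => b - c) (B x) (C x))).card : ℝ)
        ≤ (A x).card := by
    exact_mod_cast (card_le_card hdiag).trans card_image_le
  have hA0 : (0 : ℝ) < (A x).card := by exact_mod_cast (hA₁ x hx).card_pos
  have h1 : c * ((A x).card : ℝ) ≤ 1 := by
    have := hrecx.trans hle
    rw [pow_two, ← mul_assoc] at this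
    exact le_of_mul_le_mul_right (by linarith) hA0
  have h2 : (Nat.ceil (1 / c) : ℝ) < (A x).card := by
    exact_mod_cast lt_of_le_of_lt (le_max_right _ _) hxA
  have h3 : 1 / c ≤ (Nat.ceil (1 / c) : ℝ) := Nat.le_ceil _
  have h4 : 1 / c < (A x).card := h3.trans_lt h2
  rw [div_lt_iff₀ hc] at h4
  linarith [mul_comm c ((A x).card : ℝ)]

end Summit.MatrixMultiplication.MatrixMultiplication.Theorems.PairwiseCurvedTilingsLC.Negative
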